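import Literature.AlgebraicGeometry.Resolution.CanonicalResolutionSmoothCentre
import Literature.AlgebraicGeometry.Resolution.RegularSystemOfParameters
import HarnessLib

/-!
# Powers of the ideal of a regular centre vs. powers of the maximal ideal: `P^q ∩ 𝔪^(q+1) = 𝔪·P^q`

Topic: `Literature/AlgebraicGeometry/Resolution` (tree library; cell `res-hironaka`, librarian res-D-lib-2, DEDUPE
HOIST). For a regular local ring `(O, 𝔪)` and an ideal `P ⊆ 𝔪` with `O ⧸ P` regular (the local ring of a regular
scheme at a point of a REGULAR CENTRE), the `P`-adic and `𝔪`-adic filtrations are compatible in the sense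

  `P^q ∩ 𝔪^(q+1) = 𝔪 · P^q`  for every `q`

(an element of `P^q` has `𝔪`-adic order exactly `q` unless it lies in `𝔪·P^q`). Proof: by Matsumura, Thm. 14.2, `P` is
generated by a subset `{u_i : i ∈ S}` of a regular system of parameters `u` (tree
`exists_rsop_of_isRegularLocalRing_quotient`), an element of `P^q` is a form `F(u_S)` of degree `q`
(`exists_isHomogeneous_of_mem_span_pow`), and by Thm. 17.10 (`gr_𝔪(O) = k[U]`, tree
`coeff_mem_maximalIdeal_of_eval_mem_pow`) `F(u) ∈ 𝔪^(q+1)` forces all coefficients of `F` into `𝔪`, whence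
`F(u_S) ∈ 𝔪·(u_S)^q` (`eval_mem_mul_span_pow`).

This is the Literature-side public home of a lemma that existed publicly only on the Summits side
(`…Theorems.MarkedTransferCampaignW22LiftsAlongCentre.span_image_pow_inf_pow_succ_le`,
`…Lem168FromPermissibility.pow_inf_pow_succ_le_mul_of_isRegularLocalRing_quotient`) and was therefore re-proved
PRIVATELY in five `Hironaka2017/Proofs/S07Permissible` files (`Lem7p4b`, `Lem7p4d`, `Thm7p23aRational`, `U36L45Inst`,
`U36L45InstFrame`). Statements here are the ideal-level EQUALITIES plus element forms:

* `span_image_pow_inf_pow_succ_eq` — for a regular s.o.p. `x` and any index set `S`: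
  `(x_S)^q ⊓ 𝔪^(q+1) = 𝔪 * (x_S)^q`;
* `pow_inf_pow_succ_eq_of_isRegularLocalRing_quotient` — `P ≤ 𝔪`, `O ⧸ P` regular: `P^q ⊓ 𝔪^(q+1) = 𝔪 * P^q`;
* `mem_mul_pow_of_mem_pow_of_mem_pow_succ` — element form; `not_mem_pow_succ_of_mem_pow_of_not_mem_mul` — «order
  exactly `q`»; `pow_inf_pow_add_le` is NOT claimed for higher gaps (only the gap-one statement is standard here).

## References
* H. Matsumura, *Commutative Ring Theory*, CSAM 8, CUP 1986: Thm. 14.2 (book p. 106), Thm. 17.10 (book p. 137).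
  [Matsumura1987]
-/

namespace Literature.AlgebraicGeometry.Resolution

open IsLocalRing MvPolynomial

universe u

variable {O : Type u} [CommRing O] [IsRegularLocalRing O]

/-- **Matsumura 17.10, filtration form for a sub-system of parameters.** For a regular system of parameters `x` of
the regular local ring `O`, any index set `S` and `P = (x_i : i ∈ S)`: `P^q ∩ 𝔪^(q+1) = 𝔪·P^q`.
[cite: Matsumura1987, Thm. 17.10] -/
theorem span_image_pow_inf_pow_succ_eq {d : ℕ} (hd : (maximalIdeal O).spanFinrank = d) (x : Fin d → O)
    (hx : Ideal.span (Set.range x) = maximalIdeal O) (S : Set (Fin d)) (q : ℕ) :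
    Ideal.span (x '' S) ^ q ⊓ maximalIdeal O ^ (q + 1) = maximalIdeal O * Ideal.span (x '' S) ^ q := by
  classical
  refine le_antisymm ?_ ?_
  · rintro f ⟨hfP, hfm⟩
    rw [Set.image_eq_range] at hfP ⊢
    obtain ⟨F, hF, hFf⟩ := exists_isHomogeneous_of_mem_span_pow (fun s : S => x s) q hfP
    -- all coefficients of `F` lie in `𝔪`: rename to the full system and apply Matsumura 17.10
    have hcoeff : ∀ m, F.coeff m ∈ maximalIdeal O := by
      intro m
      have hG : (rename (Subtype.val : S → Fin d) F).IsHomogeneous q := hF.rename_isHomogeneous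
      have hGeval : eval x (rename (Subtype.val : S → Fin d) F) ∈ maximalIdeal O ^ (q + 1) := by
        rw [eval_rename]
        change eval (fun s : S => x s) F ∈ _
        rw [hFf]
        exact hfm
      have h := coeff_mem_maximalIdeal_of_eval_mem_pow hd x hx hG hGeval (m.mapDomain Subtype.val)
      rwa [coeff_rename_mapDomain _ Subtype.val_injective] at h
    rw [← hFf]
    exact eval_mem_mul_span_pow _ hF (mem_map_C_iff.mpr hcoeff)
  · -- `𝔪·P^q ⊆ P^q` and `𝔪·P^q ⊆ 𝔪·𝔪^q = 𝔪^(q+1)` since `P ⊆ 𝔪`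
    have hP : Ideal.span (x '' S) ≤ maximalIdeal O := by
      rw [← hx]
      exact Ideal.span_mono (Set.image_subset_range _ _)
    refine le_inf Ideal.mul_le_left ?_
    rw [pow_succ']
    exact Ideal.mul_mono_right (Ideal.pow_right_mono hP q)

/-- **`P^q ∩ 𝔪^(q+1) = 𝔪·P^q` for the ideal `P` of a regular centre** (`O` regular local, `P ⊆ 𝔪`, `O ⧸ P` regular
local): Matsumura 14.2 (`P` is generated by part of a regular system of parameters, tree
`exists_rsop_of_isRegularLocalRing_quotient`) + 17.10 (`span_image_pow_inf_pow_succ_eq`).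
[cite: Matsumura1987, Thm. 14.2 and Thm. 17.10] -/
theorem pow_inf_pow_succ_eq_of_isRegularLocalRing_quotient {P : Ideal O} (hP : P ≤ maximalIdeal O)
    [IsRegularLocalRing (O ⧸ P)] (q : ℕ) :
    P ^ q ⊓ maximalIdeal O ^ (q + 1) = maximalIdeal O * P ^ q := by
  obtain ⟨u, hu, S, hS⟩ := exists_rsop_of_isRegularLocalRing_quotient hP
  subst hS
  exact span_image_pow_inf_pow_succ_eq rfl u hu S q

/-- Element form: `f ∈ P^q` and `f ∈ 𝔪^(q+1)` imply `f ∈ 𝔪·P^q` (`O` regular local, `P ⊆ 𝔪`, `O ⧸ P` regular).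
[cite: Matsumura1987, Thm. 14.2 and Thm. 17.10] -/
theorem mem_mul_pow_of_mem_pow_of_mem_pow_succ {P : Ideal O} (hP : P ≤ maximalIdeal O)
    [IsRegularLocalRing (O ⧸ P)] {q : ℕ} {f : O} (hfP : f ∈ P ^ q) (hfm : f ∈ maximalIdeal O ^ (q + 1)) :
    f ∈ maximalIdeal O * P ^ q :=
  (pow_inf_pow_succ_eq_of_isRegularLocalRing_quotient hP q).le ⟨hfP, hfm⟩

/-- «Order exactly `q`»: an element of `P^q` outside `𝔪·P^q` has `𝔪`-adic order exactly `q`, i.e. does not lie in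
`𝔪^(q+1)` (`O` regular local, `P ⊆ 𝔪`, `O ⧸ P` regular). [cite: Matsumura1987, Thm. 14.2 and Thm. 17.10] -/
theorem not_mem_pow_succ_of_mem_pow_of_not_mem_mul {P : Ideal O} (hP : P ≤ maximalIdeal O)
    [IsRegularLocalRing (O ⧸ P)] {q : ℕ} {f : O} (hfP : f ∈ P ^ q) (hf : f ∉ maximalIdeal O * P ^ q) :
    f ∉ maximalIdeal O ^ (q + 1) :=
  fun hfm => hf (mem_mul_pow_of_mem_pow_of_mem_pow_succ hP hfP hfm)

/-- Element form for a sub-system of parameters: `f ∈ (x_S)^q ∩ 𝔪^(q+1)` ⇒ `f ∈ 𝔪·(x_S)^q`.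
[cite: Matsumura1987, Thm. 17.10] -/
theorem mem_mul_span_image_pow_of_mem_pow_succ {d : ℕ} (hd : (maximalIdeal O).spanFinrank = d)
    (x : Fin d → O) (hx : Ideal.span (Set.range x) = maximalIdeal O) (S : Set (Fin d)) {q : ℕ} {f : O}
    (hfP : f ∈ Ideal.span (x '' S) ^ q) (hfm : f ∈ maximalIdeal O ^ (q + 1)) :
    f ∈ maximalIdeal O * Ideal.span (x '' S) ^ q :=
  (span_image_pow_inf_pow_succ_eq hd x hx S q).le ⟨hfP, hfm⟩

/-- The whole maximal ideal (`S = univ`, i.e. `P = 𝔪`): `𝔪^q ∩ 𝔪^(q+1) = 𝔪^(q+1)` — recorded as the degenerate case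
`maximalIdeal O * maximalIdeal O ^ q = maximalIdeal O ^ (q + 1)` for rewriting. [cite: Matsumura1987, Thm. 17.10] -/
theorem maximalIdeal_mul_pow_eq_pow_succ (q : ℕ) :
    maximalIdeal O * maximalIdeal O ^ q = maximalIdeal O ^ (q + 1) :=
  (pow_succ' _ _).symm

/-- Monotonicity in the centre: for `P ≤ P'` both with regular quotients, `𝔪·P^q = P^q ∩ 𝔪·P'^q`
(an element of `P^q` that is `𝔪`-divisible inside the larger `P'^q` is already `𝔪`-divisible inside `P^q`).
[cite: Matsumura1987, Thm. 14.2 and Thm. 17.10] -/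
theorem mul_pow_eq_pow_inf_mul_pow_of_le {P P' : Ideal O} (hPP' : P ≤ P') (hP' : P' ≤ maximalIdeal O)
    [IsRegularLocalRing (O ⧸ P)] [IsRegularLocalRing (O ⧸ P')] (q : ℕ) :
    maximalIdeal O * P ^ q = P ^ q ⊓ (maximalIdeal O * P' ^ q) := by
  have hP : P ≤ maximalIdeal O := hPP'.trans hP'
  refine le_antisymm (le_inf Ideal.mul_le_left (Ideal.mul_mono_right (Ideal.pow_right_mono hPP' q))) ?_
  rintro f ⟨hfP, hf'⟩
  have hfm : f ∈ maximalIdeal O ^ (q + 1) :=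
    ((pow_inf_pow_succ_eq_of_isRegularLocalRing_quotient hP' q).ge hf').2
  exact mem_mul_pow_of_mem_pow_of_mem_pow_succ hP hfP hfm

end Literature.AlgebraicGeometry.Resolution
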